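import Literature.AlgebraicGeometry.AbelianSchemes.AbelianSchemeTheoremOfCubeLocallyNoetherian
import Literature.AlgebraicGeometry.AbelianSchemes.ModuleSliceOfBaseChange
import Literature.AlgebraicGeometry.AbelianSchemes.AbelianSchemeBaseChangeComp
import Literature.AlgebraicGeometry.Modules.DetClassOfIso
import Mathlib.AlgebraicGeometry.Morphisms.Flat
import Mathlib.AlgebraicGeometry.PullbackCarrier
import Mathlib.RingTheory.DualNumber
import HarnessLib

/-!
# Points of `Â = A/K(L)` are detected by the Poincaré family: `(1 × g₁)^*𝒫 ≅ (1 × g₂)^*𝒫 ⇒ g₁ = g₂` on ALL `T`-points,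
# and first-order rigidity of `𝒫` at every point as a corollary (Mumford, *Abelian Varieties* §13, relative and algebraic)

Layer `Literature/AlgebraicGeometry/AbelianSchemes`, namespace `Literature.AlgebraicGeometry.AbelianSchemes.AbelianSchemeOver`.
THEOREMS ONLY (no definition, no named fact, no instance, no `sorry`).

Setting ([MumfordAV1970] §13 p. 125; [MumfordFogartyKirwan1994] Ch. 6 §2): an abelian scheme `A → S` over a LOCALLY NOETHERIAN base,
a rank-one `L` on `A` rigidified along the zero section (`ε^*[L] = 1`), an abelian scheme `Â → S` with a FLAT SURJECTIVE homomorphism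
`π : A → Â` whose kernel on `T`-points lies in `K(L)` (`u ≫ π = 1 ↔ u ∈ K(L)(T)`, ★ `AbelianSchemeOver.MemKOfL`; only `←` is used), and a
module `𝒫` on `A ×_S Â` with `(1 × π)^*𝒫 ≅ Λ(L)` (★ `AbelianSchemeOver.mumfordBundle`).  [MumfordAV1970] §13 p. 125: «`Γ(S) = {g : S → X̂ ;
(1 × g)^*P ≅ L_S}` … the map is injective».

* §1–§2 `mumfordClass_pullback_whiskerLeft_one`, `cechPic_pullback_whiskerLeft_comp`, `mumfordClass_pullback_whiskerLeft_inv`,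
  `memKOfL_mul_inv_of_mumfordClass_eq`, `mumfordClass_pullback_eq_of_iso` — class bookkeeping for `w ↦ (1_A × w)^*[Λ(L)]` (a homomorphism
  by the ★ theorem of the square over a locally Noetherian base, `cechPic_pullback_whiskerLeft_mul_mumfordClass_of_isLocallyNoetherian`).
* §3 **`eq_of_nonempty_pullback_poincare_iso`** — for EVERY `T : Over S` and `g₁ g₂ : T ⟶ Â` over `S`:
  `(1 × g₁)^*𝒫 ≅ (1 × g₂)^*𝒫` on `A ×_S T` implies `g₁ = g₂`.  PROOF («étale-cover trick», no tangent spaces, no residue fields): on the flat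
  surjective cover `r : T″ := (T ×_{g₁,Â} A) ×_T (T ×_{g₂,Â} A) → T` both `gᵢ` lift TAUTOLOGICALLY through `π` (`aᵢ ≫ π = r ≫ gᵢ`); pulling the
  isomorphism back and using `(1 × π)^*𝒫 ≅ Λ(L)` gives `(1 × a₁)^*Λ(L) ≅ (1 × a₂)^*Λ(L)`, so by the theorem of the square `a₁ · a₂⁻¹ ∈ K(L)(T″)`,
  the kernel clause gives `a₁ ≫ π = a₂ ≫ π`, i.e. `r ≫ g₁ = r ≫ g₂`, and `r` is an epimorphism of schemes (Mathlib `Flat.epi_of_flat_of_surjective`).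
* §4 **`firstOrderRigid_of_graphCond`** — FIRST-ORDER RIGIDITY AT EVERY POINT (every commutative ring `K`): a test morphism
  `u : Spec K[ε] → T ×_S Â` over `S` with constant `T`-coordinate satisfying the graph condition «`(1 × u₂)^*𝒫 ≅ (1 × u₁)^*ℒ`» has constant
  `Â`-coordinate, `u₂ = str ≫ (inc ≫ u₂)` — the case `g₁ := u₂`, `g₂ := str ≫ inc ≫ u₂` of §3 ([GortzWedhorn2020] (6.4): tangent vectors as
  `K[ε]`-points).  This is node N3d′ of the cell's (Mc) spine and the rigidity input of W2; §3 is the lift-level Kodaira–Spencer injectivity S-d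
  of the N3′ tower in its strong form (no small-extension hypothesis).
* §5 `cechPic_pullback_unitSection_baseChange_eq_one` — the rigidification `ε^*[L] = 1` base-changes (★ `unitSection_baseChange_comp_fst`).

Cell `hodgecm-mathlib`, F-3 child line `Cruxes/HDel/Lines/F3DualAbelianSchemeM` stub (Mc); B-p07 (g20).  HC_CM is proved only modulo the 7 printed
citations until rung 0 closes; nothing here is about HC.

## References
* [MumfordAV1970] D. Mumford, *Abelian Varieties* (1970), §13, the Theorem and its proof (pp. 125–130), §6 Cor. 4 (p. 59).
* [MumfordFogartyKirwan1994] D. Mumford, J. Fogarty, F. Kirwan, *GIT*, 3rd ed. (1994), Ch. 6 §2 Def. 6.2 (p. 120), App. 7B (p. 240).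
* [GortzWedhorn2020] U. Görtz, T. Wedhorn, *Algebraic Geometry I*, 2nd ed. (2020), (6.4) and Prop. 6.7 (p. 152).
* [StacksProject] The Stacks project, Tag 02VW (a flat surjective morphism is an epimorphism of schemes; Mathlib's pin).
-/

set_option autoImplicit false

noncomputable section

-- `TopCat.Presheaf`/`Scheme.Modules` are not reducible (as in ★ `AbelianSchemeKOfL`).
set_option backward.isDefEq.respectTransparency false

open CategoryTheory CategoryTheory.Limits AlgebraicGeometry MonoidalCategory CartesianMonoidalCategory
open scoped MonObj DualNumber

namespace Literature.AlgebraicGeometry.AbelianSchemes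

open Literature.AlgebraicGeometry.Motives Literature.AlgebraicGeometry.Modules

namespace AbelianSchemeOver

/-! ## §1 Class bookkeeping for `w ↦ (1_A × w)^*[Λ(L)]` -/

section Classes

variable {S : Scheme.{0}} (A : AbelianSchemeOver S) {L : A.left.Modules} (hL : HasRank L 1)
  (hε : CechPic.pullback A.unitSection (detClass (HasRank.isFiniteLocallyFree' hL)) = 1)

include hε in
/-- `(1_A × 1)^*[Λ(L)] = 1`: the unit point lies in `K(L)` (★ `kOfL`, rigidification). [cite: MumfordFogartyKirwan1994, App. 7B, Definition of H(L) (p. 240)] -/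
theorem mumfordClass_pullback_whiskerLeft_one {T : Over S} :
    CechPic.pullback (A.X ◁ (1 : T ⟶ A.X)).left (A.mumfordClass (detClass (HasRank.isFiniteLocallyFree' hL))) = 1 :=
  (A.memKOfL_iff_mumfordClass hL (1 : T ⟶ A.X)).1 (A.kOfL L hL hε T).one_mem

/-- `(1_A × (g ≫ w))^*[x] = (1_A × g)^*((1_A × w)^*[x])` (functoriality of `A ◁ -` and of the pull-back of classes).
[cite: MumfordAV1970, §13 (p. 123)] -/
theorem cechPic_pullback_whiskerLeft_comp {T T' T'' : Over S} (g : T' ⟶ T) (w : T ⟶ T'') (x : CechPic (A.X ⊗ T'').left) :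
    CechPic.pullback (A.X ◁ (g ≫ w)).left x = CechPic.pullback (A.X ◁ g).left (CechPic.pullback (A.X ◁ w).left x) := by
  rw [MonoidalCategory.whiskerLeft_comp, Over.comp_left, CechPic.pullback_comp]

variable [IsLocallyNoetherian S]

include hε in
/-- `(1_A × w⁻¹)^*[Λ(L)] = ((1_A × w)^*[Λ(L)])⁻¹` (theorem of the square over a locally Noetherian base).
[cite: MumfordAV1970, §6 Cor. 4 (p. 59)] [cite: MumfordFogartyKirwan1994, Ch. 6 §2 Definition 6.2 (p. 120)] -/
theorem mumfordClass_pullback_whiskerLeft_inv {T : Over S} (w : T ⟶ A.X) :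
    CechPic.pullback (A.X ◁ w⁻¹).left (A.mumfordClass (detClass (HasRank.isFiniteLocallyFree' hL))) =
      (CechPic.pullback (A.X ◁ w).left (A.mumfordClass (detClass (HasRank.isFiniteLocallyFree' hL))))⁻¹ := by
  apply eq_inv_of_mul_eq_one_left
  rw [← A.cechPic_pullback_whiskerLeft_mul_mumfordClass_of_isLocallyNoetherian _ hε, inv_mul_cancel,
    A.mumfordClass_pullback_whiskerLeft_one hL hε]

include hε in
/-- **Two points with the same Mumford class differ by a point of `K(L)`**: `(1 × v)^*[Λ(L)] = (1 × w)^*[Λ(L)]` ⇒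
`v · w⁻¹ ∈ K(L)(T)` (the square makes `u ↦ (1 × u)^*[Λ(L)]` a homomorphism `A(T) → Pic(A_T)` with kernel `K(L)(T)`).
[cite: MumfordFogartyKirwan1994, Ch. 6 §2 Definition 6.2 (p. 120) and Cor. 6.8 (p. 118)] [cite: MumfordAV1970, §13 (p. 123)] -/
theorem memKOfL_mul_inv_of_mumfordClass_eq {T : Over S} (v w : T ⟶ A.X)
    (h : CechPic.pullback (A.X ◁ v).left (A.mumfordClass (detClass (HasRank.isFiniteLocallyFree' hL))) =
      CechPic.pullback (A.X ◁ w).left (A.mumfordClass (detClass (HasRank.isFiniteLocallyFree' hL)))) :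
    A.MemKOfL L (v * w⁻¹) := by
  rw [A.memKOfL_iff_mumfordClass hL, A.cechPic_pullback_whiskerLeft_mul_mumfordClass_of_isLocallyNoetherian _ hε,
    A.mumfordClass_pullback_whiskerLeft_inv hL hε, h, mul_inv_cancel]

end Classes

/-! ## §2 Reading an isomorphism of pulled-back line bundles on classes -/

section Read

variable {S : Scheme.{0}} (A : AbelianSchemeOver S) {L : A.left.Modules} (hL : HasRank L 1)

/-- **Class reading**: `a^*Λ(L) ≅ b^*ℒ` ⇒ `a^*[Λ(L)] = b^*[ℒ]` for rank-one `L`, `ℒ` (★ `detClass_mumfordBundle`, ★ `detClass_pullback`,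
★ `detClass_eq_of_iso`). [cite: Hartshorne1977, III Ex. 4.5] [cite: MumfordFogartyKirwan1994, Ch. 6 §2 Definition 6.2 (p. 120)] -/
theorem mumfordClass_pullback_eq_of_iso {Z W : Scheme.{0}} (a : Z ⟶ (A.X ⊗ A.X).left) (b : Z ⟶ W) {ℒ : W.Modules} (hℒ : HasRank ℒ 1)
    (e : (Scheme.Modules.pullback a).obj (A.mumfordBundle L) ≅ (Scheme.Modules.pullback b).obj ℒ) :
    CechPic.pullback a (A.mumfordClass (detClass (HasRank.isFiniteLocallyFree' hL))) =
      CechPic.pullback b (detClass (HasRank.isFiniteLocallyFree' hℒ)) := by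
  have hΛ : IsFiniteLocallyFree (A.mumfordBundle L) := HasRank.isFiniteLocallyFree' (A.hasRank_mumfordBundle hL)
  have hℒ' : IsFiniteLocallyFree ℒ := HasRank.isFiniteLocallyFree' hℒ
  have key := detClass_eq_of_iso e (hΛ.pullback a) (hℒ'.pullback b)
  rw [detClass_pullback a hΛ, detClass_pullback b hℒ', A.detClass_mumfordBundle hL] at key
  rw [key]

end Read

/-! ## §3 Points of `Â` are detected by `𝒫`: the étale-cover trick -/

section Points

variable {S : Scheme.{0}} [IsLocallyNoetherian S] (A hat : AbelianSchemeOver S) (π : A.X ⟶ hat.X) [IsMonHom π]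
  [Flat π.left] [Surjective π.left]
  {L : A.left.Modules} (hL : HasRank L 1)
  (hε : CechPic.pullback A.unitSection (detClass (HasRank.isFiniteLocallyFree' hL)) = 1)
  (hker : ∀ (T : Over S) (u : T ⟶ A.X), u ≫ π = 1 ↔ A.MemKOfL L u)
  (P : (A.prodLeft hat).Modules)
  (hsock : Nonempty ((Scheme.Modules.pullback (A.X ◁ π).left).obj P ≅ A.mumfordBundle L))

include hε hker hsock in
/-- **`(1 × g₁)^*𝒫 ≅ (1 × g₂)^*𝒫 ⇒ g₁ = g₂` on all `T`-points** ([MumfordAV1970] §13, the Theorem: `Â = A/K(L)` with the descended `𝒫`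
is the dual — in particular `g ↦ (1 × g)^*𝒫` is injective on `T`-points; here from: `π : A → Â` flat surjective homomorphism with
`ker π(T) ⊆ K(L)(T)`, `(1 × π)^*𝒫 ≅ Λ(L)`, `ε^*[L] = 1`, `S` locally Noetherian).  Proof: the étale-cover trick of the module docstring —
tautological lifts on `T″ = (T ×_{Â} A) ×_T (T ×_{Â} A)`, the theorem of the square (★
`cechPic_pullback_whiskerLeft_mul_mumfordClass_of_isLocallyNoetherian`), the kernel clause, and «flat surjective ⇒ epimorphism»
(Mathlib `Flat.epi_of_flat_of_surjective`). [cite: MumfordAV1970, §13 (the Theorem and its proof, pp. 125–130)]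
[cite: StacksProject, Tag 02VW] -/
theorem eq_of_nonempty_pullback_poincare_iso {T : Over S} (g₁ g₂ : T ⟶ hat.X)
    (h : Nonempty ((Scheme.Modules.pullback (A.baseChangeToProd hat T.hom g₁.left (Over.w g₁))).obj P ≅
      (Scheme.Modules.pullback (A.baseChangeToProd hat T.hom g₂.left (Over.w g₂))).obj P)) :
    g₁ = g₂ := by
  classical
  obtain ⟨φ⟩ := h
  obtain ⟨eσ⟩ := hsock
  -- the flat surjective cover `r : T″ → T` on which both `gᵢ` lift through `π`
  set q₁ : pullback g₁.left π.left ⟶ T.left := pullback.fst g₁.left π.left with hq₁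
  set q₂ : pullback g₂.left π.left ⟶ T.left := pullback.fst g₂.left π.left with hq₂
  set b₁ : pullback g₁.left π.left ⟶ A.X.left := pullback.snd g₁.left π.left with hb₁
  set b₂ : pullback g₂.left π.left ⟶ A.X.left := pullback.snd g₂.left π.left with hb₂
  have hsq₁ : q₁ ≫ g₁.left = b₁ ≫ π.left := pullback.condition
  have hsq₂ : q₂ ≫ g₂.left = b₂ ≫ π.left := pullback.condition
  set r : pullback q₁ q₂ ⟶ T.left := pullback.fst q₁ q₂ ≫ q₁ with hr
  have hr' : r = pullback.snd q₁ q₂ ≫ q₂ := pullback.condition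
  haveI : Flat r := inferInstance
  haveI : Surjective r := inferInstance
  haveI : Epi r := Flat.epi_of_flat_of_surjective r
  let T'' : Over S := Over.mk (r ≫ T.hom)
  let rO : T'' ⟶ T := Over.homMk r rfl
  have hA : A.X.hom = π.left ≫ hat.X.hom := (Over.w π).symm
  -- the tautological lifts `aᵢ : T″ → A`, `aᵢ ≫ π = r ≫ gᵢ`
  have w₁ : (pullback.fst q₁ q₂ ≫ b₁) ≫ A.X.hom = r ≫ T.hom := by
    rw [hA, Category.assoc, ← Category.assoc b₁, ← hsq₁, Category.assoc, Over.w g₁, hr, Category.assoc]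
  have w₂ : (pullback.snd q₁ q₂ ≫ b₂) ≫ A.X.hom = r ≫ T.hom := by
    rw [hA, Category.assoc, ← Category.assoc b₂, ← hsq₂, Category.assoc, Over.w g₂, hr', Category.assoc]
  let a₁ : T'' ⟶ A.X := Over.homMk (pullback.fst q₁ q₂ ≫ b₁) w₁
  let a₂ : T'' ⟶ A.X := Over.homMk (pullback.snd q₁ q₂ ≫ b₂) w₂
  have ha₁ : a₁ ≫ π = rO ≫ g₁ := Over.OverMorphism.ext (by
    change (pullback.fst q₁ q₂ ≫ b₁) ≫ π.left = r ≫ g₁.left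
    rw [Category.assoc, ← hsq₁, hr, Category.assoc])
  have ha₂ : a₂ ≫ π = rO ≫ g₂ := Over.OverMorphism.ext (by
    change (pullback.snd q₁ q₂ ≫ b₂) ≫ π.left = r ≫ g₂.left
    rw [Category.assoc, ← hsq₂, hr', Category.assoc])
  -- `(1 × aᵢ)^*Λ(L) ≅ (1 × r)^*(1 × gᵢ)^*𝒫`
  have hbc₁ : A.baseChangeToProd hat T.hom g₁.left (Over.w g₁) = (A.X ◁ g₁).left := A.baseChangeToProd_eq_whiskerLeft_left hat g₁
  have hbc₂ : A.baseChangeToProd hat T.hom g₂.left (Over.w g₂) = (A.X ◁ g₂).left := A.baseChangeToProd_eq_whiskerLeft_left hat g₂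
  have hc₁ : (A.X ◁ a₁).left ≫ (A.X ◁ π).left = (A.X ◁ rO).left ≫ (A.X ◁ g₁).left := by
    rw [← Over.comp_left, ← MonoidalCategory.whiskerLeft_comp, ha₁, MonoidalCategory.whiskerLeft_comp, Over.comp_left]
  have hc₂ : (A.X ◁ a₂).left ≫ (A.X ◁ π).left = (A.X ◁ rO).left ≫ (A.X ◁ g₂).left := by
    rw [← Over.comp_left, ← MonoidalCategory.whiskerLeft_comp, ha₂, MonoidalCategory.whiskerLeft_comp, Over.comp_left]
  let e₁ : (Scheme.Modules.pullback (A.X ◁ a₁).left).obj (A.mumfordBundle L) ≅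
      (Scheme.Modules.pullback (A.X ◁ rO).left).obj
        ((Scheme.Modules.pullback (A.baseChangeToProd hat T.hom g₁.left (Over.w g₁))).obj P) :=
    ((Scheme.Modules.pullback (A.X ◁ a₁).left).mapIso eσ).symm ≪≫
      (Scheme.Modules.pullbackComp (A.X ◁ a₁).left (A.X ◁ π).left).app P ≪≫
      eqToIso (congrArg (fun k => (Scheme.Modules.pullback k).obj P) hc₁) ≪≫
      ((Scheme.Modules.pullbackComp (A.X ◁ rO).left (A.X ◁ g₁).left).app P).symm ≪≫
      eqToIso (congrArg (fun k => (Scheme.Modules.pullback (A.X ◁ rO).left).obj ((Scheme.Modules.pullback k).obj P)) hbc₁.symm)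
  let e₂ : (Scheme.Modules.pullback (A.X ◁ a₂).left).obj (A.mumfordBundle L) ≅
      (Scheme.Modules.pullback (A.X ◁ rO).left).obj
        ((Scheme.Modules.pullback (A.baseChangeToProd hat T.hom g₂.left (Over.w g₂))).obj P) :=
    ((Scheme.Modules.pullback (A.X ◁ a₂).left).mapIso eσ).symm ≪≫
      (Scheme.Modules.pullbackComp (A.X ◁ a₂).left (A.X ◁ π).left).app P ≪≫
      eqToIso (congrArg (fun k => (Scheme.Modules.pullback k).obj P) hc₂) ≪≫
      ((Scheme.Modules.pullbackComp (A.X ◁ rO).left (A.X ◁ g₂).left).app P).symm ≪≫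
      eqToIso (congrArg (fun k => (Scheme.Modules.pullback (A.X ◁ rO).left).obj ((Scheme.Modules.pullback k).obj P)) hbc₂.symm)
  have e : Nonempty ((Scheme.Modules.pullback (A.X ◁ a₁).left).obj (A.mumfordBundle L) ≅
      (Scheme.Modules.pullback (A.X ◁ a₂).left).obj (A.mumfordBundle L)) :=
    ⟨e₁ ≪≫ (Scheme.Modules.pullback (A.X ◁ rO).left).mapIso φ ≪≫ e₂.symm⟩
  obtain ⟨e⟩ := e
  -- classes: `(1 × a₁)^*[Λ(L)] = (1 × a₂)^*[Λ(L)]`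
  have hcl := A.mumfordClass_pullback_eq_of_iso hL (A.X ◁ a₁).left (A.X ◁ a₂).left (A.hasRank_mumfordBundle hL) e
  rw [A.detClass_mumfordBundle hL] at hcl
  -- square + kernel clause: `a₁ ≫ π = a₂ ≫ π`
  have hmem : A.MemKOfL L (a₁ * a₂⁻¹) := A.memKOfL_mul_inv_of_mumfordClass_eq hL hε a₁ a₂ hcl
  have hπ1 : (a₁ * a₂⁻¹) ≫ π = 1 := (hker _ _).2 hmem
  rw [MonObj.mul_comp, GrpObj.inv_comp, mul_inv_eq_one, ha₁, ha₂] at hπ1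
  -- `r ≫ g₁ = r ≫ g₂` with `r` an epimorphism
  have hl : r ≫ g₁.left = r ≫ g₂.left := by
    have := congrArg (fun k : T'' ⟶ hat.X => k.left) hπ1
    simpa only [Over.comp_left, rO, Over.homMk_left] using this
  exact Over.OverMorphism.ext ((cancel_epi r).1 hl)

end Points

/-! ## §4 First-order rigidity at every point (the `K[ε]`-case of §3) -/

section Rigid

variable {S : Scheme.{0}} [IsLocallyNoetherian S] (A hat : AbelianSchemeOver S) (π : A.X ⟶ hat.X) [IsMonHom π]
  [Flat π.left] [Surjective π.left]
  {L : A.left.Modules} (hL : HasRank L 1)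
  (hε : CechPic.pullback A.unitSection (detClass (HasRank.isFiniteLocallyFree' hL)) = 1)
  (hker : ∀ (T : Over S) (u : T ⟶ A.X), u ≫ π = 1 ↔ A.MemKOfL L u)
  (P : (A.prodLeft hat).Modules)
  (hsock : Nonempty ((Scheme.Modules.pullback (A.X ◁ π).left).obj P ≅ A.mumfordBundle L))
  {T : Scheme.{0}} (f : T ⟶ S) (ℒ : A.RigidifiedLineBundle f)

include hε hker hsock in
/-- **FIRST-ORDER RIGIDITY OF THE POINCARÉ FAMILY AT EVERY POINT** ([MumfordAV1970] §13, proof of the Theorem: the Kodaira–Spencer map of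
`𝒫` is injective / «`Lie K(L) = 0`»; relative and algebraic; every commutative ring `K` of coefficients).  For `s : Spec K → S` and a test
morphism `u : Spec K[ε] → T ×_S Â` over `S` with CONSTANT `T`-coordinate (`u ≫ pr_T = str ≫ t`, `str : Spec K[ε] → Spec K` the structure map)
satisfying the graph condition «`(1 × u₂)^*𝒫 ≅ (1 × u₁)^*ℒ`» (spelled out through ★ `baseChangeToProd`), the `Â`-coordinate is constant:
`u ≫ pr_Â = str ≫ y` (with `y = inc ≫ u₂`, `inc = Spec(ε ↦ 0)`).  Proof: `(1 × (str ≫ inc ≫ u₂))^*𝒫` and `(1 × u₂)^*𝒫` are both isomorphic to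
`(1 × (str ≫ t))^*ℒ`, so §3 applies. [cite: MumfordAV1970, §13 (proof of the Theorem, pp. 125–130)] [cite: GortzWedhorn2020, (6.4) and Prop. 6.7 (p. 152)] -/
theorem firstOrderRigid_of_graphCond {K : Type} [CommRing K] (s : Spec (.of K) ⟶ S)
    (u : Over.mk (Spec.map (CommRingCat.ofHom (algebraMap K K[ε])) ≫ s) ⟶ Over.mk f ⊗ hat.X) (t : Over.mk s ⟶ Over.mk f)
    (hu : u ≫ fst _ _ =
      (Over.homMk (Spec.map (CommRingCat.ofHom (algebraMap K K[ε]))) rfl :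
        Over.mk (Spec.map (CommRingCat.ofHom (algebraMap K K[ε])) ≫ s) ⟶ Over.mk s) ≫ t)
    (hc : Nonempty ((Scheme.Modules.pullback (A.baseChangeToProd hat (Spec.map (CommRingCat.ofHom (algebraMap K K[ε])) ≫ s)
        (u ≫ snd _ _).left (Over.w (u ≫ snd _ _)))).obj P ≅
      (Scheme.Modules.pullback (A.X ◁ (u ≫ fst _ _)).left).obj ℒ.L)) :
    ∃ y : Over.mk s ⟶ hat.X,
      u ≫ snd _ _ = (Over.homMk (Spec.map (CommRingCat.ofHom (algebraMap K K[ε]))) rfl :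
        Over.mk (Spec.map (CommRingCat.ofHom (algebraMap K K[ε])) ≫ s) ⟶ Over.mk s) ≫ y := by
  classical
  -- the section `inc : Spec K → Spec K[ε]` (`ε ↦ 0`) of the structure map `str`
  set inc₀ : Spec (.of K) ⟶ Spec (.of K[ε]) := Spec.map (CommRingCat.ofHom (TrivSqZeroExt.fstHom K K K).toRingHom)
    with hinc₀
  have hinc₀str₀ : inc₀ ≫ Spec.map (CommRingCat.ofHom (algebraMap K K[ε])) = 𝟙 _ := by
    rw [hinc₀, ← Spec.map_comp, ← CommRingCat.ofHom_comp]
    have : (TrivSqZeroExt.fstHom K K K).toRingHom.comp (algebraMap K K[ε]) = RingHom.id K :=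
      RingHom.ext fun x => (TrivSqZeroExt.fstHom K K K).commutes x
    rw [this, CommRingCat.ofHom_id, Spec.map_id]
  let inc : Over.mk s ⟶ Over.mk (Spec.map (CommRingCat.ofHom (algebraMap K K[ε])) ≫ s) := Over.homMk inc₀ (by
    change inc₀ ≫ Spec.map (CommRingCat.ofHom (algebraMap K K[ε])) ≫ s = s
    rw [← Category.assoc, hinc₀str₀, Category.id_comp])
  set strO : Over.mk (Spec.map (CommRingCat.ofHom (algebraMap K K[ε])) ≫ s) ⟶ Over.mk s :=
    (Over.homMk (Spec.map (CommRingCat.ofHom (algebraMap K K[ε]))) rfl :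
      Over.mk (Spec.map (CommRingCat.ofHom (algebraMap K K[ε])) ≫ s) ⟶ Over.mk s) with hstrO
  have hincstr : inc ≫ strO = 𝟙 (Over.mk s) :=
    Over.OverMorphism.ext (by rw [Over.comp_left, Over.id_left]; exact hinc₀str₀)
  set u₂ : Over.mk (Spec.map (CommRingCat.ofHom (algebraMap K K[ε])) ≫ s) ⟶ hat.X := u ≫ snd _ _ with hu₂
  refine ⟨inc ≫ u₂, ?_⟩
  obtain ⟨ψ⟩ := hc
  -- morphism bookkeeping
  have hbc : A.baseChangeToProd hat (Spec.map (CommRingCat.ofHom (algebraMap K K[ε])) ≫ s) u₂.left (Over.w u₂) = (A.X ◁ u₂).left :=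
    A.baseChangeToProd_eq_whiskerLeft_left hat u₂
  have hbc' : A.baseChangeToProd hat (Spec.map (CommRingCat.ofHom (algebraMap K K[ε])) ≫ s) (strO ≫ inc ≫ u₂).left
      (Over.w (strO ≫ inc ≫ u₂)) = (A.X ◁ (strO ≫ inc ≫ u₂)).left :=
    A.baseChangeToProd_eq_whiskerLeft_left hat (strO ≫ inc ≫ u₂)
  have E1 : (A.X ◁ (strO ≫ inc ≫ u₂)).left = (A.X ◁ strO).left ≫ (A.X ◁ inc).left ≫ (A.X ◁ u₂).left := by
    rw [MonoidalCategory.whiskerLeft_comp, MonoidalCategory.whiskerLeft_comp, Over.comp_left, Over.comp_left]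
  have E2 : (A.X ◁ inc).left ≫ (A.X ◁ (strO ≫ t)).left = (A.X ◁ t).left := by
    rw [← Over.comp_left, ← MonoidalCategory.whiskerLeft_comp, ← Category.assoc, hincstr, Category.id_comp]
  have E3 : (A.X ◁ (strO ≫ t)).left = (A.X ◁ strO).left ≫ (A.X ◁ t).left := by
    rw [MonoidalCategory.whiskerLeft_comp, Over.comp_left]
  -- `(1 × u₂)^*𝒫 ≅ (1 × (str ≫ t))^*ℒ ≅ (1 × str)^*(1 × t)^*ℒ`
  let I1 : (Scheme.Modules.pullback (A.X ◁ u₂).left).obj P ≅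
      (Scheme.Modules.pullback (A.X ◁ strO).left).obj ((Scheme.Modules.pullback (A.X ◁ t).left).obj ℒ.L) :=
    eqToIso (congrArg (fun k => (Scheme.Modules.pullback k).obj P) hbc.symm) ≪≫ ψ ≪≫
      eqToIso (congrArg (fun k : Over.mk (Spec.map (CommRingCat.ofHom (algebraMap K K[ε])) ≫ s) ⟶ Over.mk f =>
        (Scheme.Modules.pullback (A.X ◁ k).left).obj ℒ.L) hu) ≪≫
      eqToIso (congrArg (fun k => (Scheme.Modules.pullback k).obj ℒ.L) E3) ≪≫
      ((Scheme.Modules.pullbackComp (A.X ◁ strO).left (A.X ◁ t).left).app ℒ.L).symm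
  -- `(1 × t)^*ℒ ≅ (1 × inc)^*(1 × (str ≫ t))^*ℒ ≅ (1 × inc)^*(1 × u₂)^*𝒫`
  let I2 : (Scheme.Modules.pullback (A.X ◁ t).left).obj ℒ.L ≅
      (Scheme.Modules.pullback (A.X ◁ inc).left).obj ((Scheme.Modules.pullback (A.X ◁ u₂).left).obj P) :=
    eqToIso (congrArg (fun k => (Scheme.Modules.pullback k).obj ℒ.L) E2.symm) ≪≫
      ((Scheme.Modules.pullbackComp (A.X ◁ inc).left (A.X ◁ (strO ≫ t)).left).app ℒ.L).symm ≪≫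
      (Scheme.Modules.pullback (A.X ◁ inc).left).mapIso
        (eqToIso (congrArg (fun k : Over.mk (Spec.map (CommRingCat.ofHom (algebraMap K K[ε])) ≫ s) ⟶ Over.mk f =>
          (Scheme.Modules.pullback (A.X ◁ k).left).obj ℒ.L) hu.symm) ≪≫ ψ.symm ≪≫
          eqToIso (congrArg (fun k => (Scheme.Modules.pullback k).obj P) hbc))
  -- assemble: `(1 × u₂)^*𝒫 ≅ (1 × (str ≫ inc ≫ u₂))^*𝒫`
  let J : (Scheme.Modules.pullback (A.baseChangeToProd hat (Spec.map (CommRingCat.ofHom (algebraMap K K[ε])) ≫ s) u₂.left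
        (Over.w u₂))).obj P ≅
      (Scheme.Modules.pullback (A.baseChangeToProd hat (Spec.map (CommRingCat.ofHom (algebraMap K K[ε])) ≫ s)
        (strO ≫ inc ≫ u₂).left (Over.w (strO ≫ inc ≫ u₂)))).obj P :=
    eqToIso (congrArg (fun k => (Scheme.Modules.pullback k).obj P) hbc) ≪≫ I1 ≪≫
      (Scheme.Modules.pullback (A.X ◁ strO).left).mapIso (I2 ≪≫
        (Scheme.Modules.pullbackComp (A.X ◁ inc).left (A.X ◁ u₂).left).app P) ≪≫
      (Scheme.Modules.pullbackComp (A.X ◁ strO).left ((A.X ◁ inc).left ≫ (A.X ◁ u₂).left)).app P ≪≫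
      eqToIso (congrArg (fun k => (Scheme.Modules.pullback k).obj P) E1.symm) ≪≫
      eqToIso (congrArg (fun k => (Scheme.Modules.pullback k).obj P) hbc'.symm)
  have key := A.eq_of_nonempty_pullback_poincare_iso hat π hL hε hker P hsock u₂ (strO ≫ inc ≫ u₂) ⟨J⟩
  rw [← Category.assoc]
  exact key

end Rigid

/-! ## §5 The rigidification base-changes -/

section BaseChange

variable {S S' : Scheme.{0}} (A : AbelianSchemeOver S) (g : S' ⟶ S) {L : A.left.Modules} (hL : HasRank L 1)

/-- `ε_{A_{S′}}^*[L|_{A_{S′}}] = g^*(ε_A^*[L]) = 1`: the rigidification of `L` along the zero section base-changes along `g : S′ → S`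
(★ `unitSection_baseChange_comp_fst`, ★ `detClass_pullback`). [cite: MumfordFogartyKirwan1994, Ch. 6 §2 Definition 6.2 (p. 120)] -/
theorem cechPic_pullback_unitSection_baseChange_eq_one
    (hε : CechPic.pullback A.unitSection (detClass (HasRank.isFiniteLocallyFree' hL)) = 1) :
    CechPic.pullback (A.baseChange g).unitSection
      (detClass (HasRank.isFiniteLocallyFree'
        (hasRank_pullback (pullback.fst A.X.hom g) hL))) = 1 := by
  have h1 : detClass (HasRank.isFiniteLocallyFree' (hasRank_pullback (pullback.fst A.X.hom g) hL)) =
      detClass ((HasRank.isFiniteLocallyFree' hL).pullback (pullback.fst A.X.hom g)) := rfl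
  calc CechPic.pullback (A.baseChange g).unitSection
        (detClass (HasRank.isFiniteLocallyFree' (hasRank_pullback (pullback.fst A.X.hom g) hL)))
      = CechPic.pullback (A.baseChange g).unitSection
          (CechPic.pullback (pullback.fst A.X.hom g) (detClass (HasRank.isFiniteLocallyFree' hL))) :=
        congrArg (CechPic.pullback (A.baseChange g).unitSection)
          (h1.trans (detClass_pullback (pullback.fst A.X.hom g) (HasRank.isFiniteLocallyFree' hL)))
    _ = CechPic.pullback ((A.baseChange g).unitSection ≫ pullback.fst A.X.hom g)
          (detClass (HasRank.isFiniteLocallyFree' hL)) := by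
        rw [CechPic.pullback_comp]; rfl
    _ = 1 := by rw [unitSection_baseChange_comp_fst, CechPic.pullback_comp, hε, map_one]

end BaseChange

end AbelianSchemeOver

end Literature.AlgebraicGeometry.AbelianSchemes

end
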